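import Literature.Computability.QuantumComplexity.GuidedPauliHamiltonian
import Literature.Computability.Cryptography.ClassBQP
import HarnessLib

/-!
# BQP-hardness of the guided Pauli-Hamiltonian problem at inverse-polynomial precision

The hardness half of the Gharibian–Le Gall dichotomy for the *guided local Hamiltonian
problem* [GharibianLegall2022, Thm 2]:

> **Theorem 2.** For any `δ ∈ (0, 1/√2 − Ω(1/poly(n)))`, there exist parameters `a, b ∈ [0,1]`
> with `b − a = Ω(1/poly(n))` such that `GLH*(6, a, b, δ)` is `BQP`-hard.

Here `GLH*(k, a, b, δ)` is the box of [GharibianLegall2022, §1.2]: input a `k`-local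
Hamiltonian `H` on `n` qubits with `‖H‖ ≤ 1` and the description (the list `S`,
`|S| = poly(n)`) of a semi-classical subset state `u = |S|^{-1/2} Σ_{w ∈ S} |w⟩`; promises
(i) `‖Π_H u‖ ≥ δ` (`Π_H` = projector onto the ground space of `H`) and (ii) `λ_H ≤ a` or
`λ_H ≥ b`; goal: decide which.  "BQP-hard" is under polynomial-time many-one reductions from
every promise problem of `BQP` [GharibianLegall2022, §3, first paragraph of the proof].

This file vendors the theorem as ONE named fact, `GharibianLeGall2022_thm2`, TRANSCRIBED onto
the tree's instance format `guidedPauliHamiltonianProblem' c χ₀` of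
`GuidedPauliHamiltonian.lean` (whose module docstring announces exactly this filing: the
sibling with precision schedule `g(n) = n^c + c` is "the regime `b − a = Ω(1/poly(n))` of
[GharibianLegall2022, Thm 2], whose transcription is to be filed against it"), and proves the
elementary monotonicity facts that make the fact usable at any smaller overlap bound.
Nothing here is a new mathematical claim; the `Prop` is the printed theorem read through the
five deltas (i)–(v) of that docstring, as follows (each step is routine and stated so that a
reviewer can check the transcription, not the theorem):

* *Languages vs promise problems.* The tree's `BQP` (`Literature.Computability.Cryptography.BQP`,
  Clifford+T, error `1/3`) is a class of languages; `PromiseProblem.IsHard BQP Q` asks for a Karp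
  reduction `ofLanguage L ≤ₚ Q` (an `FP` map sending `L` into `Q.yes` and `Lᶜ` into `Q.no`) for
  every `L ∈ BQP` — the language special case of the printed reductions from promise-`BQP`.
* *Weight ring (delta (ii) of the format: weights `p + q√2 ∈ ℤ[√2]`).*  The reduction of
  [GharibianLegall2022, §3] outputs `H = ((α'+β')/2)·I ⊗ |0⟩⟨0|_D + H' ⊗ |1⟩⟨1|_D`,
  `H' = Δ(H_in + H_prop + H_stab) + H_out`, the Kitaev clock Hamiltonian of the (error-reduced,
  pre-idled) verifier circuit `U = U_M ⋯ U_1`, with `H_prop` built from the gates `U_t`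
  (`−½ U_t ⊗ |t⟩⟨t−1| − ½ U_t† ⊗ |t−1⟩⟨t| + …`).  For the tree's `BQP` the gates are Clifford+T,
  whose entries lie in `2^{-r} ℤ[i, √2]`; the Pauli coefficients `2^{-n} Tr(P·M)` of the Hermitian
  terms are therefore real elements of `2^{-r'} ℤ[i, √2]`, i.e. lie in `2^{-r'} ℤ[√2]`, and the
  rational constants `(α'+β')/2`, `Δ` can be taken with a common denominator; multiplying `H` by
  one positive integer puts every weight in `ℤ[√2]` and changes nothing else, because the format
  measures energies relative to the Pauli 1-norm `Λ` (delta (i)) — no normalisation `‖H‖ ≤ 1` is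
  needed (the printed proof normalises "by dividing `H` by any polynomial bound on `‖H‖`", §3).
* *Locality (delta (iii)).* The format imposes no locality, so the `6`-local (with Clifford+T and
  the `D` register: `O(1)`-local) output needs no further comment; each local term expands into
  `O(1)` Pauli strings, so the term list is computed in polynomial time.
* *Thresholds (deltas (i), (v)).* The printed thresholds are `a = α'`, `b = (α'+β')/2` with
  `b − a = Ω(1/poly(M))`, `M ≤` (number of qubits of the output instance); after the integer
  scaling, `Λ = Σ_t |p_t + q_t√2| = poly` in the same variable, so the RELATIVE gap is still
  `≥ 1/(N^c + c)` in the output qubit number `N` for one exponent `c` (depending on the constant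
  slack `1/√2 − χ₀` through the polynomials `Δ, Δ', N` of the printed proof, not on `L`: every
  `L ∈ BQP` first passes through its own uniform circuit family, and all bounds of §3 are
  polynomial in the circuit size `M`).  The instance thresholds `α/(D+1) ≥ a/Λ` and
  `β/(D+1) ≤ b/Λ` are rational approximations computed in polynomial time (`Λ` is a computable
  real), which is all the format asks (`l(D+1) ≤ αΛ` on YES, `βΛ ≤ l(D+1)` on NO).
* *Guide and overlap (deltas (ii), (iv)).* The printed guide
  `u = |x⟩|0⋯0⟩ (N^{-1/2} Σ_{t=1}^{N} |t⟩) |+⟩_D` is a subset state over `2N` strings, i.e. a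
  signed-subset list with all signs `+`.  Printed YES (`λ_H ≤ a`, `‖Π_H u‖ ≥ δ`) gives the
  format's YES with the eigenpair `(λ_H, Π_H u)`: `H Π_H u = λ_H Π_H u`, `Π_H u ≠ 0`, and
  `|⟨u, Π_H u⟩|² / (‖u‖² ‖Π_H u‖²) = ‖Π_H u‖²/‖u‖² ≥ δ²`; printed NO (`λ_H ≥ b`) is the format's NO
  verbatim (every eigenvalue `≥ bΛ` in relative units).  Hence with `χ₀ = δ`.
* *Range of `δ`.* For a CONSTANT `χ₀ < 1/√2` the slack `1/√2 − χ₀` is a positive constant, in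
  particular `Ω(1/poly(n))`; the fact is stated for constant `χ₀ ∈ (0, 1/√2)` only, with the
  exponent `c` allowed to depend on `χ₀` (`∀ χ₀, ∃ c`), which is the literal reading.

Strengthening in print, NOT vendored here: Cade–Folkertsma–Gharibian–Hayakawa–Le Gall–
Morimae–Weggemans (ICALP 2023, LIPIcs 261, 32; arXiv:2207.10250, abstract): BQP-completeness
persists "even with 2-local Hamiltonians, and even when the guiding state has fidelity
(inverse-polynomially) close to 1 with a ground state".  Companion classical results (constant
precision), NOT here: [GharibianLegall2022, Thm 1], [Gall2024, Thms 3–4].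

Wanted by: cell pub-qadeq (DEQ-A28, instance-level adjudication; no claim about BQP vs BPP or
the summit) as work item wi-44331, and route `NeedleThreshold` of `QuantumAdvantage` (its thesis
names this transcription `ClockHardness`, the support layer under crux `GuidedHardness`).

## References

* [GharibianLegall2022] S. Gharibian, F. Le Gall, *Dequantizing the quantum singular value
  transformation: hardness and applications to quantum chemistry and the quantum PCP
  conjecture*, STOC 2022, 19–32; SIAM J. Comput. 52(4) (2023); arXiv:2111.09079 — §1.2 (box
  `GLH*(k,a,b,δ)`, semi-classical states), Thm 2, §3 (proof: Kitaev clock, pre-idling, Ambainis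
  query-gadget register `D`).
* C. Cade, M. Folkertsma, S. Gharibian, R. Hayakawa, F. Le Gall, T. Morimae, J. Weggemans,
  *Improved hardness results for the guided local Hamiltonian problem*, ICALP 2023 (LIPIcs 261,
  32:1–32:19), arXiv:2207.10250 (context only; not cited by any declaration).
* [Gall2024] F. Le Gall, *Classical algorithms for constant approximation of the ground state
  energy of local Hamiltonians*, ESA 2025 (LIPIcs 351:73), arXiv:2410.21833.

## Mathlib / tree search

`lean search 'IsHard|BQPHard|guidedPauli'` (2026-08-19): `PromiseProblem.IsHard`
(Promise.lean), `guidedPauliHamiltonianProblem'` (GuidedPauliHamiltonian.lean),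
`Literature.Computability.Cryptography.BQP` (ClassBQP.lean); no hardness fact for the guided
problem anywhere in the tree (the route items inline their own antecedents).  Reused, not
re-declared: all of the above.
-/

noncomputable section

namespace Literature.Computability.QuantumComplexity

open Literature.Computability.Complexity Literature.Computability.Cryptography

/-! ### The named fact -/

/-- **Gharibian–Le Gall, BQP-hardness of the guided local Hamiltonian problem at
inverse-polynomial precision**, transcribed onto the tree's instance format (module docstring):
for every constant overlap bound `χ₀ ∈ (0, 1/√2)` there is a precision exponent `c` such that
the guided Pauli-Hamiltonian promise problem with relative promise gap `b − a ≥ 1/(n^c + c)` and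
YES-side overlap `≥ χ₀`, `guidedPauliHamiltonianProblem' c χ₀`, is `BQP`-hard under
polynomial-time Karp reductions of promise problems (`PromiseProblem.IsHard`).  As printed:
"For any `δ ∈ (0, 1/√2 − Ω(1/poly(n)))`, there exist parameters `a, b ∈ [0,1]` with
`b − a = Ω(1/poly(n))` such that `GLH*(6, a, b, δ)` is BQP-hard."
[cite: GharibianLegall2022, Thm 2] -/
def GharibianLeGall2022_thm2 : Prop :=
  ∀ χ₀ : ℝ, 0 < χ₀ → χ₀ < 1 / Real.sqrt 2 →
    ∃ c : ℕ, (guidedPauliHamiltonianProblem' c χ₀).IsHard BQP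

/-! ### Monotonicity in the overlap bound (proved; makes the fact usable at any `χ₁ ≤ χ₀`) -/

variable {n : ℕ}

/-- YES data is antitone in the overlap bound: an eigenpair witnessing overlap `≥ χ₀` witnesses
overlap `≥ χ₁` for every `0 ≤ χ₁ ≤ χ₀`. [folklore] -/
theorem IsGuidedPauliYes.anti {g : ℕ → ℝ} {χ₀ χ₁ : ℝ} (h₁ : 0 ≤ χ₁) (h₁₀ : χ₁ ≤ χ₀)
    {terms : List (GuidedPauliTerm n)} {guide : List (Bool × (Fin n → Bool))} {α β : ℤ} {D : ℕ}
    (h : IsGuidedPauliYes g χ₀ n terms guide α β D) : IsGuidedPauliYes g χ₁ n terms guide α β D := by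
  obtain ⟨hΛ, hgap, hu, l, v, hv, hHv, hl, hov⟩ := h
  refine ⟨hΛ, hgap, hu, l, v, hv, hHv, hl, le_trans ?_ hov⟩
  have hsq : χ₁ ^ 2 ≤ χ₀ ^ 2 := pow_le_pow_left₀ h₁ h₁₀ 2
  have hA : 0 ≤ ∑ y, ‖signedSubsetState guide y‖ ^ 2 :=
    Finset.sum_nonneg fun y _ => pow_nonneg (norm_nonneg _) 2
  have hB : 0 ≤ ∑ y, ‖v y‖ ^ 2 := Finset.sum_nonneg fun y _ => pow_nonneg (norm_nonneg _) 2
  exact mul_le_mul_of_nonneg_right (mul_le_mul_of_nonneg_right hsq hA) hB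

/-- The YES instance set is antitone in the overlap bound. [folklore] -/
theorem guidedPauliYesSet_anti (g : ℕ → ℝ) {χ₀ χ₁ : ℝ} (h₁ : 0 ≤ χ₁) (h₁₀ : χ₁ ≤ χ₀) :
    guidedPauliYesSet g χ₀ ⊆ guidedPauliYesSet g χ₁ := by
  rintro I ⟨n, terms, guide, α, β, D, rfl, hyes⟩
  exact ⟨n, terms, guide, α, β, D, rfl, hyes.anti h₁ h₁₀⟩

/-- A Karp reduction into a promise problem is a Karp reduction into any promise problem with
larger YES and NO sets. [folklore] -/
theorem _root_.Literature.Computability.Complexity.PromiseProblem.PolyTimeReducible.mono_right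
    {Q₁ Q₂ Q₃ : PromiseProblem} (h : Q₁.PolyTimeReducible Q₂) (hyes : Q₂.yes ≤ Q₃.yes)
    (hno : Q₂.no ≤ Q₃.no) : Q₁.PolyTimeReducible Q₃ := by
  obtain ⟨f, hf, hy, hn⟩ := h
  exact ⟨f, hf, fun x hx => hyes (hy hx), fun x hx => hno (hn hx)⟩

/-- Hardness transfers to any promise problem with larger YES and NO sets. [folklore] -/
theorem _root_.Literature.Computability.Complexity.PromiseProblem.IsHard.mono_right
    {C : Set (Language Bool)} {Q₂ Q₃ : PromiseProblem} (h : Q₂.IsHard C)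
    (hyes : Q₂.yes ≤ Q₃.yes) (hno : Q₂.no ≤ Q₃.no) : Q₃.IsHard C :=
  fun L hL => (h L hL).mono_right hyes hno

/-- Lowering the overlap bound of the guided Pauli-Hamiltonian problem (any schedule) preserves
`C`-hardness: the YES set grows, the NO set is unchanged. [folklore] -/
theorem isHard_guidedPauliProblem_anti {C : Set (Language Bool)} (g : ℕ → ℝ) {χ₀ χ₁ : ℝ}
    (h₁ : 0 ≤ χ₁) (h₁₀ : χ₁ ≤ χ₀) (h : (guidedPauliProblem g χ₀).IsHard C) :
    (guidedPauliProblem g χ₁).IsHard C :=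
  h.mono_right (Computability.Encoding.toLanguage_mono _ (guidedPauliYesSet_anti g h₁ h₁₀))
    le_rfl

/-- Consequence of the fact: hardness at EVERY overlap bound `χ₁ ∈ (0, 1/√2)` with an exponent
that may be taken from any larger `χ₀ < 1/√2` — in particular one exponent `c` serves a whole
interval `[χ₁, χ₀]` of overlap bounds. [cite: GharibianLegall2022, Thm 2] -/
theorem GharibianLeGall2022_thm2.isHard_of_le (hGL : GharibianLeGall2022_thm2) {χ₀ χ₁ : ℝ}
    (h₁ : 0 < χ₁) (h₁₀ : χ₁ ≤ χ₀) (h₀ : χ₀ < 1 / Real.sqrt 2) :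
    ∃ c : ℕ, ∀ χ ∈ Set.Icc χ₁ χ₀, (guidedPauliHamiltonianProblem' c χ).IsHard BQP := by
  obtain ⟨c, hc⟩ := hGL χ₀ (lt_of_lt_of_le h₁ h₁₀) h₀
  exact ⟨c, fun χ hχ => isHard_guidedPauliProblem_anti _ (le_trans h₁.le hχ.1) hχ.2 hc⟩

/-! ### The promise transfer used in the transcription, as a lemma (proved)

The module docstring's step "printed YES (`λ_H ≤ a`, `‖Π_H u‖ ≥ δ`) gives the format's YES with
the eigenpair `(λ_H, Π_H u)`" rests on one line of algebra: if `u = v + w` with `w ⊥ v` then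
`⟨u, v⟩ = ‖v‖²`, so `‖v‖ ≥ χ‖u‖` is exactly the format's overlap inequality
`χ² ‖u‖² ‖v‖² ≤ |⟨u, v⟩|²`.  It is recorded here in the coordinates the format uses (finite sums
over `Fin n → Bool`), so that a prover of the transcription (route `NeedleThreshold`,
`ClockHardness`) can discharge the YES side from a ground-space decomposition of the guide. -/

/-- If `u = v + w` coordinatewise with `Σ_y conj(w y)·v y = 0`, then `Σ_y conj(u y)·v y = Σ_y ‖v y‖²`.
[folklore] -/
theorem inner_eq_normSq_of_decomposition {ι : Type*} [Fintype ι] {u v w : ι → ℂ}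
    (hsum : ∀ y, u y = v y + w y) (horth : ∑ y, star (w y) * v y = 0) :
    ∑ y, star (u y) * v y = ((∑ y, ‖v y‖ ^ 2 : ℝ) : ℂ) := by
  have h1 : ∑ y, star (u y) * v y = ∑ y, star (v y) * v y + ∑ y, star (w y) * v y := by
    rw [← Finset.sum_add_distrib]
    refine Finset.sum_congr rfl fun y _ => ?_
    rw [hsum y, star_add, add_mul]
  rw [h1, horth, add_zero]
  push_cast
  refine Finset.sum_congr rfl fun y _ => ?_
  rw [Complex.star_def, Complex.conj_mul']

/-- **Overlap from an orthogonal decomposition.**  If `u = v + w` with `w ⊥ v` (as finite sums)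
and `χ² ‖u‖² ≤ ‖v‖²`, then `χ² ‖u‖² ‖v‖² ≤ |⟨u, v⟩|²` — the format's YES-side overlap inequality
for the pair `(u, v)`.  With `v = Π_H u` the ground-space projection this is the promise transfer
of the transcription. [folklore] -/
theorem overlap_sq_of_decomposition {ι : Type*} [Fintype ι] {u v w : ι → ℂ} {χ : ℝ}
    (hsum : ∀ y, u y = v y + w y) (horth : ∑ y, star (w y) * v y = 0)
    (hχ : χ ^ 2 * ∑ y, ‖u y‖ ^ 2 ≤ ∑ y, ‖v y‖ ^ 2) :
    χ ^ 2 * (∑ y, ‖u y‖ ^ 2) * (∑ y, ‖v y‖ ^ 2) ≤ ‖∑ y, star (u y) * v y‖ ^ 2 := by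
  have hB : 0 ≤ ∑ y, ‖v y‖ ^ 2 := Finset.sum_nonneg fun y _ => pow_nonneg (norm_nonneg _) 2
  rw [inner_eq_normSq_of_decomposition hsum horth, Complex.norm_real, Real.norm_of_nonneg hB]
  calc χ ^ 2 * (∑ y, ‖u y‖ ^ 2) * (∑ y, ‖v y‖ ^ 2)
      ≤ (∑ y, ‖v y‖ ^ 2) * (∑ y, ‖v y‖ ^ 2) := mul_le_mul_of_nonneg_right hχ hB
    _ = (∑ y, ‖v y‖ ^ 2) ^ 2 := (sq _).symm

/-- **YES data from printed YES data.**  Given the common promise (`0 < Λ`, relative gap), a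
non-zero guide `u`, an eigenpair `H v = l v`, `v ≠ 0`, with `l (D+1) ≤ α Λ`, and an orthogonal
decomposition `u = v + w`, `w ⊥ v`, with `χ₀² ‖u‖² ≤ ‖v‖²` (i.e. `‖Π u‖ ≥ χ₀ ‖u‖` for `v = Π u`),
the instance data satisfies `IsGuidedPauliYes g χ₀`. [folklore] -/
theorem IsGuidedPauliYes.of_decomposition {g : ℕ → ℝ} {χ₀ : ℝ}
    {terms : List (GuidedPauliTerm n)} {guide : List (Bool × (Fin n → Bool))} {α β : ℤ} {D : ℕ}
    (hΛ : 0 < pauliOneNorm terms) (hgap : ((D : ℝ) + 1) ≤ ((β : ℝ) - α) * g n)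
    (hu : 0 < ∑ y, ‖signedSubsetState guide y‖ ^ 2) {l : ℝ} {v w : (Fin n → Bool) → ℂ}
    (hv : v ≠ 0) (hHv : (guidedPauliHamiltonian terms).mulVec v = (l : ℂ) • v)
    (hl : l * ((D : ℝ) + 1) ≤ (α : ℝ) * pauliOneNorm terms)
    (hsum : ∀ y, signedSubsetState guide y = v y + w y) (horth : ∑ y, star (w y) * v y = 0)
    (hχ : χ₀ ^ 2 * ∑ y, ‖signedSubsetState guide y‖ ^ 2 ≤ ∑ y, ‖v y‖ ^ 2) :
    IsGuidedPauliYes g χ₀ n terms guide α β D :=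
  ⟨hΛ, hgap, hu, l, v, hv, hHv, hl, overlap_sq_of_decomposition hsum horth hχ⟩

end Literature.Computability.QuantumComplexity
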